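import Summits.QuantumFields.YangMills.Theorems.UnitScaleTiltHalvingP1FlatCoreSupplierTopCallBaseTraceFree
import Summits.QuantumFields.YangMills.Theorems.UnitScaleTiltHalvingP1FlatCoreTopTargetRep
import Literature.MathematicalPhysics.QuantumFieldTheory.Balaban1983to89.B8SockHFPCubeMember
import HarnessLib

/-!
# `hP1room` PROGRAMME (LEAD-H BOARD v3 «H = hSupUρ3 ⟸ hMember», (K-site) «top half», `K − n = 1` BRANCH → ★w7): ★★★ THE TOP-STEP ROWS OF ONE SITE FROM THE
# SOCKETS AT THE BASE MEMBER — ✓p652996 `topRows_of_preGauge_base_traceFree` AT N05's CUBE MEMBER OF RECORD, geometry and `hrep` discharged, the [4] letters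
# as ONE package: the `k = 1` sibling of ✓p654110 `HalvingHSiteTopRowsOfSockets.siteTopRows_of_sockets`

Route `UnitScaleTilt`, crux K1 child «MinimiserStabilityRegPr» (stmt-QuantumFields-19200), registered stub `stub_halvingStep` (`BirthV10`), display «H = hSupUρ3 ⟸
hMember» (LEAD-H (K-final) ∕ ★★OWNER; per-site composer `siteRows_of_sockets(_base)` over ✓p647313's 22 rows).  Cell `ym3-torus` (HUMAN RULING D-0037: YM₃ on T³ is
ladder rung R3 — NOT d = 4, NOT a mass gap, NOT the Clay problem), width seat `ym-ust-19200-w7` gen 5 (★w3-20520 g6 «w7: k = 1 branch MINE (yours)» 18:11Z).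
`--supports stmt-QuantumFields-19200 --as helper`; THEOREMS ONLY (0 `def`, 0 `sorry`); count-neutral; nothing here claims `hSupU`, `hMember`, the stub, the crux or
the gap.

WHAT.  ★★★ `siteTopRows_of_sockets_base` — EXACTLY ✓p654110's statement shape at a member with `k = 1` (binder `(hk1 : k = 1)`, every row written in `k` so the
`K − n = 1` composer instantiates `k := K − n` without rewriting under binders), with the blocks that do not arise at the base member DROPPED: NO group data, NO
Theorem-4 datum (`u₁ := 1`, `U₁ := U′`; the rows `hu₁ hu₁H hW h129 hLan hdat`), NO b9 socket `SB9`, NO Proposition-3 ∕ JOIN ∕ lower-family windows (`hside hC₂ h61 hsmall₁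
hcBlo hcAlo hcDAlo hα3 hα4 hsmall hc₃ hsc hα₃' hs₁…hs₇ hprod8 hCblo hCllo`), NO (1.33)∕(1.34)∕Ax∕(1.35) rows — and in their place THE BASE DATUM of ✓p650673∕✓p652996: the chart
one-form `A` Hermitian and `τ`-free with `U′ = e^{iηA}`, `η‖A‖ ≤ 2s` on both bonds `(x, μ)`, `(x − e_μ, μ)` at every `x ∈ Ω 0` (✓`HalvingP1FlatCoreSupplierPreGaugeMember`
`baseDatum_of_preGauge_cubeMember` supplies them at the J3 instance), its two windows `L·(2s) ≤ cA`, `4dL²s ≤ cDA`, `cA ≤ 1∕13`, and `0 ≤ Cb`, `0 ≤ Cl`.  KEPT VERBATIM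
(✓p654110's letters at `m + 1 := k`): the site `x₀`, the cube member of record `Ω := cubeFam false L a M′ ρ′ k`, `Λs := cubeLamS L a M′ ρ′ k` (defining equations,
callers write `rfl`), `ha`, `hroomW` (⇒ `hrep` by ✓p642293 `hrep_cubeLamS`; `htower` by lit ✓`htw_cubeLamS`; `hΩ` by lit ✓`hΩ_cubeFam`), the [4] LETTERS + laws +
τ-fields as ONE ∃-PACKAGE `SLetτ`, `hCbρ hClB`, the charted iterate `W₁` and F3's tower `κf` (letters), the torus target block `th hτ hth hthk hthlo haxT hthτ`
[(K-DE) ✓p651548 at `k = 1`], the top windows `ha₁' … h106`, the three top rows + `hTopTrace` [(K-DE)].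
CONCLUSION = ✓p654110's eight conjuncts at `m + 1 := k = 1` with `rep := lift x₀ + rel x₀`, `y₀ := Bᵏx₀`, `u₁⁻¹ := (1 : Site P.d → 𝔸ˣ)⁻¹` (so the k-generic sizes half
✓p654113 and knit ✓p655738 read it exactly as they read ✓p654110's).
HONEST SCOPE.  By-name instantiation of ✓p652996; nothing of Proposition 5, Theorem 4, [4], `core′` or the stub is proved here.

References: T. Bałaban, CMP **99** (1985) 75–102 [Balaban1985RegularSpaces] (Prop. 5 (1.106)–(1.109) p.94, Thm 4 p.88 («for k = 1»), (1.4)–(1.6) p.77, (1.131)–(1.133) p.99);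
CMP **99** (1985) 389–434 [Balaban1985BackgroundPropagators] (Thm 3.1 p.397, (3.25) p.394); CMP **98** (1985) 17–51 [Balaban1985Averaging] ((208)–(214) p.50).
-/

set_option autoImplicit false

noncomputable section

open scoped BigOperators
open NormedSpace
open Complex (I)

namespace Summit.QuantumFields.YangMills.Theorems.HalvingHSiteTopRowsOfSocketsBase

open Literature.MathematicalPhysics.QuantumFieldTheory.Balaban1983to89
open T4Continuum
open MatrixLog (mlog)
open B5Eq118OneStroke (iterBlockOf)
open B7Prop1Explicit (Site e expUnit)
open B7Prop1Local (InBox)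
open B7Eq78Linearization (conjR zdBlocking QprimeIter)
open B8Ineq130 (tlo thi)
open B8Ineq132 (covDerivFwd)
open B8Eq119TwistedAxial (bgT)
open B8Eq131Cubes (gs)
open B8Eq131CubesAdmissible (cubeFam)
open B8CubeMemberZd (cubeLamS hΩ_cubeFam)
open B8SockHFPCubeMember (htw_cubeLamS)
open B8Eq184Proof (gaugeExp cfgExp)
open B8Eq182Proof (gAd)
open B8Eq188Proof (frakF3)
open B8Eq140Level (SideTouches)
open B8Eq138LandauZd (covDivB covLap QT)
open B8Eq1117Concrete (XSpace)
open B8Prop5ContractionKLevel (Bd2 Mc Kc)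
open B8LambdaSpaceKLevel (wt)
open B8Eq178Averages (Qnl)
open B10Eq27TorusAxialLog (rel axialT)
open B15Eq112TorusCover (lift cover)
open Node00 (coverAt)
open LatticeFieldCalculus (siteAvgIter)
open Summit.QuantumFields.YangMills.Theorems.Prop8ChartDoubleBar (dbarIterU)
open HalvingP1FlatCoreSupplierTopCallBaseTraceFree (topRows_of_preGauge_base_traceFree)
open P1FlatCoreTopTargetRep (hrep_cubeLamS)

variable {P : Params} {𝔸 : Type*} [CStarAlgebra 𝔸] [Nontrivial 𝔸]

/-- ★★★ **THE TOP-STEP ROWS OF ONE SITE FROM THE SOCKETS AT THE BASE MEMBER (`k = 1`)** — see the module docstring: ✓p652996 `topRows_of_preGauge_base_traceFree` at N05's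
cube member of record with the member geometry and `hrep` discharged, the base datum rows displayed, the [4] letters as one package; conclusion = ✓p654110's eight
conjuncts at `m + 1 := k`, `u₁ := 1`. [cite: Balaban1985RegularSpaces, Prop. 5 (1.106)-(1.109) p.94, Thm 4 p.88, (1.4)-(1.6) p.77, (1.131)-(1.133) p.99; Balaban1985BackgroundPropagators, Thm 3.1 p.397, (3.25) p.394; Balaban1985Averaging, (208)-(214) p.50] -/
theorem siteTopRows_of_sockets_base (τ : 𝔸 →L[ℂ] ℂ) (hτtr : ∀ x y : 𝔸, τ (x * y) = τ (y * x)) (hd2 : 2 ≤ P.d) (hL : 2 ≤ P.L) {η : ℝ} (hη : 0 < η)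
    -- the site, N05's cube member OF RECORD `Ω_j := □_j = cubeFam false L a M′ ρ′ k j` with its tower structure (defining equations, callers write `rfl`), the BASE level `k = 1`
    (x₀ : Literature.MathematicalPhysics.QuantumFieldTheory.Balaban1983to89.Site P 0) {a : Site P.d} {M' ρ' : ℕ} (hρ' : P.L ≤ ρ')
    {k : ℕ} (hk1 : k = 1) (hkP : k ≤ P.m + P.K)
    (ha : ∀ ν, a ν ≤ ((iterBlockOf k x₀ ν).val : ℤ) ∧ ((iterBlockOf k x₀ ν).val : ℤ) ≤ a ν + M' - 1)
    (hroomW : 2 * (P.L ^ k * (M' + 1) + ρ' * gs P.L k) ≤ P.sitesPerDir 0)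
    {Ω : ℕ → Set (Site P.d)} (hΩdef : Ω = cubeFam false P.L a M' ρ' k)
    {Λs : ℕ → ℕ → Set (Site P.d)} (hΛsdef : Λs = cubeLamS P.L a M' ρ' k)
    -- THE BASE DATUM: the pre-gauged field `U′` IS `e^{iηA}` with `A` Hermitian and `τ`-free, `η‖A‖ ≤ 2s`, on both bonds at every `x ∈ Ω₀` (✓`…SupplierPreGaugeMember` rows)
    {U' : Site P.d → Fin P.d → 𝔸ˣ} {A : Site P.d → Fin P.d → 𝔸} (hAsa : ∀ x μ, IsSelfAdjoint (A x μ)) (hAτ : ∀ x μ, τ (A x μ) = 0) {s : ℝ} (hs : 0 ≤ s)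
    (hArows : ∀ x ∈ Ω 0, ∀ μ : Fin P.d,
      (U' x μ = cfgExp η A x μ ∧ η * ‖A x μ‖ ≤ 2 * s) ∧ (U' (x - e μ) μ = cfgExp η A (x - e μ) μ ∧ η * ‖A (x - e μ) μ‖ ≤ 2 * s))
    -- its two windows and the JOIN's `cA ≤ 1∕13`
    {α₄ cA cDA : ℝ} (hα₄ : 0 < α₄) (hcAw : (P.L : ℝ) * (2 * s) ≤ cA) (hcDAw : 4 * (P.d : ℝ) * (P.L : ℝ) ^ 2 * s ≤ cDA) (hcA' : cA ≤ 1 / 13)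
    -- the [4] LETTERS at `(k, U₀ := 1)` AS ONE PACKAGE (✓p654110's `SLetτ` VERBATIM at `m + 1 := k`)
    {B₀'H B₂' BG BR : ℝ} (hB₀'H : 0 < B₀'H) (hB₂' : 0 ≤ B₂') (hBG : 0 ≤ BG) (hBR : 0 ≤ BR)
    (SLetτ : ∃ (g Δ : (Site P.d → 𝔸) →ₗ[ℂ] (Site P.d → 𝔸)) (q : (Site P.d → 𝔸) →ₗ[ℂ] (ℕ → Site P.d → 𝔸))
        (qs : (ℕ → Site P.d → 𝔸) →ₗ[ℂ] (Site P.d → 𝔸)) (Aw c : (ℕ → Site P.d → 𝔸) →ₗ[ℂ] (ℕ → Site P.d → 𝔸)) (H' : XSpace P.d k 𝔸 →ₗ[ℂ] (Site P.d → 𝔸)),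
      (∀ x, ∀ y ∈ Ω 0, (Δ (g x) + qs (Aw (q (g x)))) y = x y) ∧ (∀ f, q (g (g (qs (c (q f))))) = q f) ∧
      (∀ (f : Site P.d → 𝔸), ∀ x ∈ Ω 0, Δ f x = covLap η (1 : Site P.d → Fin P.d → 𝔸ˣ) ((Ω 0).indicator f) x) ∧
      (∀ (μ : ℕ → Site P.d → 𝔸), ∀ x ∈ Ω 0, qs μ x = QT P.L k (Λs k) (1 : Site P.d → Fin P.d → 𝔸ˣ) μ x) ∧
      (∀ (f : Site P.d → 𝔸) (j : ℕ), j ≤ k → ∀ y ∈ Λs k j, q f j y = QprimeIter (zdBlocking P.d P.L) (bgT P.L (1 : Site P.d → Fin P.d → 𝔸ˣ)) j f y) ∧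
      (∀ (X : XSpace P.d k 𝔸) (x : Site P.d), ‖H' X x‖ ≤ B₀'H * ‖X‖) ∧
      (∀ j, j ≤ k → ∀ (X : XSpace P.d k 𝔸), ∀ p ∈ {b : Site P.d × Fin P.d | SideTouches (Ω j) b.1 b.2},
        wt P.L η j * ‖covDerivFwd η (1 : Site P.d → Fin P.d → 𝔸ˣ) p.2 (H' X) p.1‖ ≤ B₀'H * ‖X‖) ∧
      (∀ X : XSpace P.d k 𝔸, Bd2 P.L η k Ω (covLap η (1 : Site P.d → Fin P.d → 𝔸ˣ) (H' X)) (B₂' * ‖X‖)) ∧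
      (∀ (X : XSpace P.d k 𝔸) (x : Site P.d), x ∉ Ω 0 → H' X x = 0) ∧
      (∀ X Y : XSpace P.d k 𝔸, (∀ p, Y p = -star (X p)) → ∀ x, H' Y x = -star (H' X x)) ∧
      (∀ (Y : XSpace P.d k 𝔸) (j : ℕ) (hj : j ≤ k) (y : Site P.d), y ∈ Λs k j →
        QprimeIter (zdBlocking P.d P.L) (bgT P.L (1 : Site P.d → Fin P.d → 𝔸ˣ)) j (H' Y) y = Y (⟨j, Nat.lt_succ_of_le hj⟩, y)) ∧
      (∀ (f : Site P.d → 𝔸) (r : ℝ), 0 ≤ r → Bd2 P.L η k Ω f r →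
        (∀ x, ‖g f x‖ ≤ BG * r) ∧ ∀ j, j ≤ k → ∀ p ∈ {b : Site P.d × Fin P.d | SideTouches (Ω j) b.1 b.2},
          wt P.L η j * ‖covDerivFwd η (1 : Site P.d → Fin P.d → 𝔸ˣ) p.2 (g f) p.1‖ ≤ BG * r) ∧
      (∀ (f : Site P.d → 𝔸) (x : Site P.d), x ∉ Ω 0 → g f x = 0) ∧
      (∀ f : Site P.d → 𝔸, (∀ j, j ≤ k → ∀ x ∈ Ω j, IsSelfAdjoint (f x)) → ∀ x, IsSelfAdjoint (g f x)) ∧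
      (∀ (f : Site P.d → 𝔸) (r : ℝ), 0 ≤ r → Bd2 P.L η k Ω f r → Bd2 P.L η k Ω (f - g (qs (c (q (g f))))) (BR * r)) ∧
      (∀ f : Site P.d → 𝔸, (∀ j, j ≤ k → ∀ x ∈ Ω j, IsSelfAdjoint (f x)) → ∀ j, j ≤ k → ∀ x ∈ Ω j, IsSelfAdjoint ((f - g (qs (c (q (g f))))) x)) ∧
      (∀ X : XSpace P.d k 𝔸, (∀ p, τ (X p) = 0) → ∀ x, τ (H' X x) = 0) ∧
      (∀ f : Site P.d → 𝔸, (∀ j, j ≤ k → ∀ x ∈ Ω j, τ (f x) = 0) → ∀ x, τ (g f x) = 0) ∧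
      (∀ f : Site P.d → 𝔸, (∀ j, j ≤ k → ∀ x ∈ Ω j, τ (f x) = 0) → ∀ j, j ≤ k → ∀ x ∈ Ω j, τ ((f - g (qs (c (q (g f))))) x) = 0))
    -- the family constants of the top step (no lower family at the base: only nonnegativity) and their windows
    {Cb Cl : ℝ} (hCb : 0 ≤ Cb) (hCl : 0 ≤ Cl) (hCbρ : Cb ≤ α₄ / (2 * B₀'H)) (hClB : Cl * B₀'H ≤ 1 / 2)
    -- (D) the torus side: the charted iterate, F3's tower, the target (✓p636261's letters VERBATIM at the member, `y₀ := Bᵏx₀`)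
    (W₁ : GaugeField P 0 𝔸ˣ) (κf : (Literature.MathematicalPhysics.QuantumFieldTheory.Balaban1983to89.Site P 0 → 𝔸) → (i : ℕ) → GaugeTransf P i 𝔸ˣ)
    (th : XSpace P.d k 𝔸) (hτ : B₀'H * ‖th‖ < α₄ / 4) (hth : ∀ p, star (th p) = -th p)
    (hthk : ∀ yc ∈ Λs k k, th (⟨k, Nat.lt_succ_self k⟩, yc) = mlog ((axialT (dbarIterU k W₁) (iterBlockOf k x₀) (coverAt P k yc) : 𝔸ˣ) : 𝔸))
    (hthlo : ∀ (j : ℕ) (hj : j < k) (y : Site P.d), y ∈ Λs k j → th (⟨j, Nat.lt_succ_of_lt hj⟩, y) = 0)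
    (haxT : ∀ yc ∈ Λs k k, ‖((axialT (dbarIterU k W₁) (iterBlockOf k x₀) (coverAt P k yc) : 𝔸ˣ) : 𝔸) - 1‖ < 1)
    -- the top-step windows at the Sect. E sizes (✓p636261's letters VERBATIM, `B₀' := B₀'H`)
    (ha₁' : α₄ / 4 + B₀'H * (Cb + ‖th‖) ≤ 1 / 24) (hb₁' : α₄ / 4 + B₀'H * (Cb + ‖th‖) ≤ 1 / 140)
    (hθ : 10 * (α₄ / 4 + B₀'H * (Cb + ‖th‖)) * BR ≤ 1 / 2) (hh₀' : B₀'H * (Cb + ‖th‖) ≤ 3 * α₄ / 4)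
    (h103 : BG * Mc P.d BR (α₄ / 4 + B₀'H * (Cb + ‖th‖)) cA (B₂' * (Cb + ‖th‖)) cDA ≤ α₄ / 4)
    (h106 : BG * Kc P.d BR (α₄ / 4 + B₀'H * (Cb + ‖th‖)) cA (B₂' * (Cb + ‖th‖)) cDA (B₂' * (2 * Cl)) (1 + B₀'H * (2 * Cl)) (1 + B₀'H * (2 * Cl))
      ≤ 1 / 2)
    -- (E) the three top rows in torus letters on the tower box (✓p636261's letters VERBATIM at the member)
    (hTop121 : ∀ yc ∈ Λs k k, ∀ l₀ : Literature.MathematicalPhysics.QuantumFieldTheory.Balaban1983to89.Site P 0 → 𝔸,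
      (∀ x : Site P.d, InBox (tlo P.L yc k) (thi P.L yc k) x → ‖l₀ (cover P x)‖ ≤ α₄) →
      (∀ (x : Site P.d) (κ : Fin P.d), InBox (tlo P.L yc k) (thi P.L yc k) x → InBox (tlo P.L yc k) (thi P.L yc k) (x + e κ) →
        ‖l₀ (cover P (x + e κ)) - l₀ (cover P x)‖ ≤ α₄ * ((P.L : ℝ) ^ k)⁻¹) →
      exp (mlog ((κf l₀ k (coverAt P k yc) : 𝔸ˣ) : 𝔸)) = ((κf l₀ k (coverAt P k yc) : 𝔸ˣ) : 𝔸) ∧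
        ‖mlog ((κf l₀ k (coverAt P k yc) : 𝔸ˣ) : 𝔸) - siteAvgIter k l₀ (coverAt P k yc)‖ ≤ Cb)
    (hTop125 : ∀ yc ∈ Λs k k, ∀ (l₁ l₂ : Literature.MathematicalPhysics.QuantumFieldTheory.Balaban1983to89.Site P 0 → 𝔸) (r : ℝ), 0 ≤ r →
      (∀ x : Site P.d, InBox (tlo P.L yc k) (thi P.L yc k) x → ‖l₁ (cover P x)‖ ≤ α₄) →
      (∀ (x : Site P.d) (κ : Fin P.d), InBox (tlo P.L yc k) (thi P.L yc k) x → InBox (tlo P.L yc k) (thi P.L yc k) (x + e κ) →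
        ‖l₁ (cover P (x + e κ)) - l₁ (cover P x)‖ ≤ α₄ * ((P.L : ℝ) ^ k)⁻¹) →
      (∀ x : Site P.d, InBox (tlo P.L yc k) (thi P.L yc k) x → ‖l₂ (cover P x)‖ ≤ α₄) →
      (∀ (x : Site P.d) (κ : Fin P.d), InBox (tlo P.L yc k) (thi P.L yc k) x → InBox (tlo P.L yc k) (thi P.L yc k) (x + e κ) →
        ‖l₂ (cover P (x + e κ)) - l₂ (cover P x)‖ ≤ α₄ * ((P.L : ℝ) ^ k)⁻¹) →
      (∀ x : Site P.d, InBox (tlo P.L yc k) (thi P.L yc k) x → ‖l₁ (cover P x) - l₂ (cover P x)‖ ≤ r) →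
      (∀ (x : Site P.d) (κ : Fin P.d), InBox (tlo P.L yc k) (thi P.L yc k) x → InBox (tlo P.L yc k) (thi P.L yc k) (x + e κ) →
        ‖(l₁ (cover P (x + e κ)) - l₂ (cover P (x + e κ))) - (l₁ (cover P x) - l₂ (cover P x))‖ ≤ r * ((P.L : ℝ) ^ k)⁻¹) →
      ‖(mlog ((κf l₁ k (coverAt P k yc) : 𝔸ˣ) : 𝔸) - siteAvgIter k l₁ (coverAt P k yc)) -
          (mlog ((κf l₂ k (coverAt P k yc) : 𝔸ˣ) : 𝔸) - siteAvgIter k l₂ (coverAt P k yc))‖ ≤ Cl * r)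
    (hTopReal : ∀ yc ∈ Λs k k, ∀ l₀ : Literature.MathematicalPhysics.QuantumFieldTheory.Balaban1983to89.Site P 0 → 𝔸,
      (∀ x : Site P.d, InBox (tlo P.L yc k) (thi P.L yc k) x → ‖l₀ (cover P x)‖ ≤ α₄) →
      (∀ (x : Site P.d) (κ : Fin P.d), InBox (tlo P.L yc k) (thi P.L yc k) x → InBox (tlo P.L yc k) (thi P.L yc k) (x + e κ) →
        ‖l₀ (cover P (x + e κ)) - l₀ (cover P x)‖ ≤ α₄ * ((P.L : ℝ) ^ k)⁻¹) →
      mlog ((κf (fun s => -star (l₀ s)) k (coverAt P k yc) : 𝔸ˣ) : 𝔸) - siteAvgIter k (fun s => -star (l₀ s)) (coverAt P k yc) =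
        -star (mlog ((κf l₀ k (coverAt P k yc) : 𝔸ˣ) : 𝔸) - siteAvgIter k l₀ (coverAt P k yc)))
    -- (τ) the torus τ-rows of (τ-3): the target and the top member
    (hthτ : ∀ p, τ (th p) = 0)
    (hTopTrace : ∀ yc ∈ Λs k k, ∀ l₀ : Literature.MathematicalPhysics.QuantumFieldTheory.Balaban1983to89.Site P 0 → 𝔸, (∀ s, τ (l₀ s) = 0) →
      (∀ x : Site P.d, InBox (tlo P.L yc k) (thi P.L yc k) x → ‖l₀ (cover P x)‖ ≤ α₄) →
      (∀ (x : Site P.d) (κ : Fin P.d), InBox (tlo P.L yc k) (thi P.L yc k) x → InBox (tlo P.L yc k) (thi P.L yc k) (x + e κ) →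
        ‖l₀ (cover P (x + e κ)) - l₀ (cover P x)‖ ≤ α₄ * ((P.L : ℝ) ^ k)⁻¹) →
      τ (mlog ((κf l₀ k (coverAt P k yc) : 𝔸ˣ) : 𝔸) - siteAvgIter k l₀ (coverAt P k yc)) = 0) :
    ∃ lam : Site P.d → 𝔸, (∀ x, IsSelfAdjoint (lam x)) ∧ (∀ x, x ∉ Ω 0 → lam x = 0) ∧ (∀ x, τ (lam x) = 0) ∧
      (∀ j, j ≤ k → ∀ b ∈ {b : Site P.d × Fin P.d | SideTouches (Ω j) b.1 b.2},
        ‖lam b.1‖ ≤ α₄ ∧ wt P.L η j * ‖covDerivFwd η (1 : Site P.d → Fin P.d → 𝔸ˣ) b.2 lam b.1‖ ≤ α₄) ∧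
      (∃ μ : ℕ → Site P.d → 𝔸, ∀ x ∈ Ω 0,
        covLap η (1 : Site P.d → Fin P.d → 𝔸ˣ) ((Ω 0).indicator fun y =>
          covDivB η (1 : Site P.d → Fin P.d → 𝔸ˣ) A y + covLap η (1 : Site P.d → Fin P.d → 𝔸ˣ) lam y +
          ((conjR (gaugeExp lam y)⁻¹ (covDivB η (1 : Site P.d → Fin P.d → 𝔸ˣ) A y) - covDivB η (1 : Site P.d → Fin P.d → 𝔸ˣ) A y) +
            (gAd (covLap η (1 : Site P.d → Fin P.d → 𝔸ˣ) lam y) (lam y) - covLap η (1 : Site P.d → Fin P.d → 𝔸ˣ) lam y) +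
            ∑ μ, frakF3 η (1 : Site P.d → Fin P.d → 𝔸ˣ) lam A y μ)) x = QT P.L k (Λs k) (1 : Site P.d → Fin P.d → 𝔸ˣ) μ x) ∧
      (∀ j, j < k → ∀ y ∈ Λs k j,
        Qnl P.L (1 : Site P.d → Fin P.d → 𝔸ˣ) (fun x => expUnit (((-I) • lam) x)) (1 : Site P.d → 𝔸ˣ)⁻¹ j y = 0) ∧
      (∀ yc ∈ Λs k k, κf (((-I) • lam) ∘ fun s : Literature.MathematicalPhysics.QuantumFieldTheory.Balaban1983to89.Site P 0 => lift P x₀ + rel x₀ s) k (coverAt P k yc) = axialT (dbarIterU k W₁) (iterBlockOf k x₀) (coverAt P k yc)) ∧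
      (∀ x ∈ Ω 0, ∀ μ : Fin P.d,
        wt P.L η 0 * ‖A x μ‖ ≤ cA ∧ wt P.L η 0 * ‖conjR ((1 : Site P.d → Fin P.d → 𝔸ˣ) (x - e μ) μ)⁻¹ (A (x - e μ) μ)‖ ≤ cA) := by
  subst hk1 hΩdef hΛsdef
  have hL1 : 1 ≤ P.L := le_trans (by norm_num) hL
  -- the member geometry (lit `B8CubeMemberZd` ∕ `B8SockHFPCubeMember`, BY NAME) and the representative law (✓p642293)
  have hΩ := hΩ_cubeFam (d := P.d) hL1 a M' hρ' 1
  have htower := htw_cubeLamS (d := P.d) hL1 a M' ρ' 1 1 le_rfl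
  have hrep := hrep_cubeLamS (P := P) hkP x₀ ha hroomW
  -- the letters
  obtain ⟨g, Δ, q, qs, Aw, c, H', g_rightΩ, c_range, hΔ, hqs, hq, hH0, hH1, hH2, hHsupp, hHequiv, hQH, hG, hGsupp, hGreal, hRbd, hRreal, hHτ, hGτ, hRτ⟩ := SLetτ
  -- THE CALL (✓p652996, BY NAME)
  obtain ⟨lam, hsa, hsupp, hτ0, h108, hmult, hlo, htopId, hA0⟩ := topRows_of_preGauge_base_traceFree (P := P) τ hτtr hd2 hL hη hkP hΩ htower hAsa hAτ hs hArows
    hα₄ hcAw hcDAw hcA' g Δ q qs Aw c g_rightΩ c_range hΔ hqs hq H' hB₀'H hB₂' hBG hBR hH0 hH1 hH2 hHsupp hHequiv hQH hG hGsupp hGreal hRbd hRreal hCb hCl hCbρ hClB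
    W₁ κf (fun s => lift P x₀ + rel x₀ s) hrep (iterBlockOf 1 x₀) th hτ hth hthk hthlo haxT ha₁' hb₁' hθ hh₀' h103 h106 hTop121 hTop125 hTopReal
    hRτ hGτ hHτ hthτ hTopTrace
  refine ⟨lam, hsa, hsupp, hτ0, h108, hmult, fun j hj y hy => ?_, htopId, hA0⟩
  rw [inv_one]
  exact hlo j hj y hy

end Summit.QuantumFields.YangMills.Theorems.HalvingHSiteTopRowsOfSocketsBase

end
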